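import Mathlib
import Summits.ValiantsHypothesis.ValiantsHypothesis.Theorems.ProofCarryingSymmetryRestorationQPESatDefs

/-!
# Route ProofCarryingSymmetry — crux `RestorationQP`, line `registered`: leaf counts under constant folding

Support file for the crux item `stmt-ValiantsHypothesis-10343` (lead c5, rung S3^(1)-inv, stub
`esat_nvars_cnorm_le`).  The number of variable leaves `ACStability.nvars` (…ESatDefs.lean) is the
measure by which the pieces of a generic distributivity pattern are shown never to contain the
pattern again.  This file proves its bookkeeping API:

* `nvars` is additive over the flattened summands / factors (`nvars_eq_sum_addArgs`,
  `nvars_eq_sum_mulArgs`) and over left-nested sums and products (`nvars_sumL`, `nvars_prodL`);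
* the additive and multiplicative normal shapes of the constant-folding normaliser
  (…ConstNorm.lean) preserve it: `nvars_asplit`, `nvars_msplit`, `nvars_amerge`, `nvars_mmerge`,
  `nvars_amk`, `nvars_mmk`; hence the smart sum is additive (`nvars_sadd`) and the smart product is
  additive unless a constant `0` kills it (`nvars_smul_of_ne`, `nvars_smul_le`);
* the root factors of a normal form carry all its leaves (`nvars_margs_sum`,
  `nvars_le_of_mem_margs`), subformulas have at most as many leaves (`nvars_le_of_mem_subs`), and
  sums of `ACClass.nvars` are monotone in the multiset (`ACClass.nvars_sum_le_of_le`);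
* **`esat_nvars_cnorm_le`** (registered): constant folding never creates variable leaves,
  `nvars (cnorm F) ≤ nvars F`.

Everything here is an elementary structural induction; no named facts.
-/

-- single-problem summit: `Summit.ValiantsHypothesis.ValiantsHypothesis.…` is the namespace by design (D-0017)
set_option linter.dupNamespace false

noncomputable section

open scoped Classical

namespace Summit.ValiantsHypothesis.ValiantsHypothesis.Theorems

namespace ACStability

open Literature.Computability.AlgebraicComplexity ACClass

universe u v

variable {𝔽 : Type u} {X : Type v}

/-! ### Leaf counts of flattened sums and products -/

/-- The leaves of a formula are those of its flattened summands. [folklore] -/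
theorem nvars_eq_sum_addArgs (F : PIFormula 𝔽 X) : nvars F = ((addArgs F).map nvars).sum := by
  induction F with
  | var x => simp [addArgs]
  | const c => simp [addArgs]
  | add F G ihF ihG => simp [ihF, ihG]
  | mul F G _ _ => simp [addArgs]

/-- The leaves of a formula are those of its flattened factors. [folklore] -/
theorem nvars_eq_sum_mulArgs (F : PIFormula 𝔽 X) : nvars F = ((mulArgs F).map nvars).sum := by
  induction F with
  | var x => simp [mulArgs]
  | const c => simp [mulArgs]
  | add F G _ _ => simp [mulArgs]
  | mul F G ihF ihG => simp [ihF, ihG]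

/-- The leaves of a left-nested sum. [folklore] -/
theorem nvars_sumL (u : PIFormula 𝔽 X) (us : List (PIFormula 𝔽 X)) :
    nvars (sumL u us) = nvars u + (us.map nvars).sum := by
  induction us generalizing u with
  | nil => simp
  | cons w ws ih =>
    simp only [sumL_cons, ih, nvars_add, List.map_cons, List.sum_cons]
    omega

/-- The leaves of a left-nested product. [folklore] -/
theorem nvars_prodL (u : PIFormula 𝔽 X) (us : List (PIFormula 𝔽 X)) :
    nvars (prodL u us) = nvars u + (us.map nvars).sum := by
  induction us generalizing u with
  | nil => simp
  | cons w ws ih =>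
    simp only [prodL_cons, ih, nvars_mul, List.map_cons, List.sum_cons]
    omega

/-- Subformulas have at most as many leaves. [folklore] -/
theorem nvars_le_of_mem_subs {F K : PIFormula 𝔽 X} (h : K ∈ subs F) : nvars K ≤ nvars F := by
  induction F with
  | var x => simp [subs] at h; simp [h]
  | const c => simp [subs] at h; simp [h]
  | add F G ihF ihG =>
    simp only [subs, List.mem_cons, List.mem_append] at h
    rcases h with rfl | h | h
    · exact le_rfl
    · exact (ihF h).trans (by simp)
    · exact (ihG h).trans (by simp)
  | mul F G ihF ihG =>
    simp only [subs, List.mem_cons, List.mem_append] at h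
    rcases h with rfl | h | h
    · exact le_rfl
    · exact (ihF h).trans (by simp)
    · exact (ihG h).trans (by simp)

/-- Sums of class leaf counts are monotone in the multiset. [folklore] -/
theorem ACClass.nvars_sum_le_of_le {K K' : Multiset (ACClass 𝔽 X)} (h : K ≤ K') :
    (K.map ACClass.nvars).sum ≤ (K'.map ACClass.nvars).sum := by
  obtain ⟨T, rfl⟩ := Multiset.le_iff_exists_add.1 h
  simp

/-! ### Leaf counts of the normal shapes -/

/-- Merging non-constant summands adds the leaves. [folklore] -/
theorem nvars_amerge (x y : Option (PIFormula 𝔽 X)) :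
    (amerge x y).elim 0 nvars = x.elim 0 nvars + y.elim 0 nvars := by
  cases x <;> cases y <;> simp [amerge]

/-- Merging non-constant factors adds the leaves. [folklore] -/
theorem nvars_mmerge (x y : Option (PIFormula 𝔽 X)) :
    (mmerge x y).elim 0 nvars = x.elim 0 nvars + y.elim 0 nvars := by
  cases x <;> cases y <;> simp [mmerge]

/-- The flattened factors of an optional pure part carry its leaves. [folklore] -/
theorem nvars_omulArgs_sum (m : Option (PIFormula 𝔽 X)) :
    ((omulArgs m).map nvars).sum = m.elim 0 nvars := by
  cases m with
  | none => simp
  | some p => simpa using (nvars_eq_sum_mulArgs p).symm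

section Semiring

variable [CommSemiring 𝔽]

/-- All leaves of a formula sit in its non-constant summand. [folklore] -/
theorem nvars_asplit (a : PIFormula 𝔽 X) : (asplit a).1.elim 0 nvars = nvars a := by
  cases a with
  | var x => simp
  | const c => simp
  | mul p q => simp
  | add p q =>
    cases q with
    | const c => simp
    | _ => simp [asplit]

/-- All leaves of a formula sit in its non-constant factor. [folklore] -/
theorem nvars_msplit (a : PIFormula 𝔽 X) : (msplit a).1.elim 0 nvars = nvars a := by
  cases a with
  | var x => simp
  | const c => simp
  | add p q => simp
  | mul p q =>
    cases q with
    | const c => simp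
    | _ => simp [msplit]

/-- Reassembling a sum keeps the leaves of the non-constant part. [folklore] -/
theorem nvars_amk (m : Option (PIFormula 𝔽 X)) (c : 𝔽) : nvars (amk m c) = m.elim 0 nvars := by
  cases m with
  | none => simp
  | some p =>
    by_cases hc : c = 0
    · subst hc; simp
    · simp [amk_some_of_ne p hc]

/-- Reassembling a product keeps the leaves of the non-constant part. [folklore] -/
theorem nvars_mmk (m : Option (PIFormula 𝔽 X)) (c : 𝔽) : nvars (mmk m c) = m.elim 0 nvars := by
  cases m with
  | none => simp
  | some p =>
    by_cases hc : c = 1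
    · subst hc; simp
    · simp [mmk_some_of_ne p hc]

/-- **The smart sum is additive on leaves.** [folklore] -/
theorem nvars_sadd (a b : PIFormula 𝔽 X) : nvars (sadd a b) = nvars a + nvars b := by
  rw [sadd, nvars_amk, nvars_amerge, nvars_asplit, nvars_asplit]

/-- The smart product is additive on leaves when no constant `0` kills it. [folklore] -/
theorem nvars_smul_of_ne (a b : PIFormula 𝔽 X) (h : (msplit a).2 * (msplit b).2 ≠ 0) :
    nvars (smul a b) = nvars a + nvars b := by
  rw [smul_of_ne_zero h, nvars_mmk, nvars_mmerge, nvars_msplit, nvars_msplit]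

/-- **The smart product never creates leaves.** [folklore] -/
theorem nvars_smul_le (a b : PIFormula 𝔽 X) : nvars (smul a b) ≤ nvars a + nvars b := by
  by_cases h : (msplit a).2 * (msplit b).2 = 0
  · rw [smul_of_eq_zero h]; simp
  · exact (nvars_smul_of_ne a b h).le

/-- **Constant folding never creates leaves**: `nvars (cnorm F) ≤ nvars F`. [folklore] -/
theorem nvars_cnorm_le (F : PIFormula 𝔽 X) : nvars (cnorm F) ≤ nvars F := by
  induction F with
  | var x => simp
  | const c => simp
  | add F G ihF ihG =>
    rw [cnorm_add, nvars_sadd, nvars_add]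
    omega
  | mul F G ihF ihG =>
    have := nvars_smul_le (cnorm F) (cnorm G)
    rw [cnorm_mul, nvars_mul]
    omega

/-! ### Root factors -/

/-- The root factors of a formula carry all its leaves. [folklore] -/
theorem nvars_margs_sum (x : PIFormula 𝔽 X) : ((margs x).map nvars).sum = nvars x := by
  rw [margs_def, nvars_omulArgs_sum, nvars_msplit]

/-- A root factor has at most as many leaves. [folklore] -/
theorem nvars_le_of_mem_margs {x f : PIFormula 𝔽 X} (h : f ∈ margs x) : nvars f ≤ nvars x := by
  rw [← nvars_margs_sum x]
  exact List.le_sum_of_mem (List.mem_map.2 ⟨f, h, rfl⟩)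

end Semiring

end ACStability

open Literature.Computability.AlgebraicComplexity in
/-- **Constant folding never creates variable leaves** (registered helper of crux `RestorationQP`,
line `registered`, rung S3^(1)-inv): the constant-normal form `cnorm F` has at most as many variable
leaves as `F` (it can only delete leaves, through `x · 0 ↦ 0`). [folklore] -/
theorem esat_nvars_cnorm_le : ∀ {𝔽 : Type} [Field 𝔽] {X : Type} (F : PIFormula 𝔽 X), ACStability.nvars (ACStability.cnorm F) ≤ ACStability.nvars F :=
  fun F => ACStability.nvars_cnorm_le F

end Summit.ValiantsHypothesis.ValiantsHypothesis.Theorems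

end
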